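import Literature.MathematicalPhysics.QuantumFieldTheory.Balaban1983to89.B8Eq138LandauZdRec
import Literature.MathematicalPhysics.QuantumFieldTheory.Balaban1983to89.B8Prop5KLevelLetters

/-!
# `Balaban1983to89.B8Prop5KLevelLettersRec` — RECORD TWIN of `B8Prop5KLevelLetters` ([Balaban1985RegularSpaces] PROPOSITION 5 (p. 94) AT `k` LEVELS: the provider's
# side of the sockets `hP5base`∕`hP5` of the Theorem-4 driver at `Lan := IsLandau138WZ`) for the SYMMETRISED CENTRED block averaging (0.4) of [Balaban1987RG1]

statement-level skeleton of published theorems with citation tags; proofs where landed; nothing here is a claim about the Yang–Mills mass gap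

T. Bałaban, *Spaces of regular gauge field configurations on a lattice and gauge fixing conditions*, Commun. Math. Phys. **99** (1985) 75–102
`[Balaban1985RegularSpaces]` ("[6]"): Prop. 5 pp. 93–94, (1.106)–(1.110) p. 94, (1.84)–(1.88) p. 91, (1.95)–(1.96) p. 92, (1.38) p. 82, (1.29) p. 81, (1.78) p. 90, Thm 4 p. 88;
T. Bałaban, *Renormalization group approach to lattice gauge field theories. I*, Commun. Math. Phys. **109** (1987) 249–301 `[Balaban1987RG1]` ("[I]"): (0.3)–(0.4)
pp. 252–253, pp. 253–254.  STATUS: published, refereed.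

CITATION HEADER (lean-in-tree rule).  Cell `pub-ymgap`, base `pub-ymgap-dag-n05-c` g26 — N05-REC stage 2 (director-ym №254∕№255), item R5, LEAD PEN dag-n05-e
g35 (inventory `N05-REC-INVENTORY.md` e50db04501ab292d §R5 row `B8Prop5KLevelLetters`: A `hP5base_of_HFP hP5_of_HFP multiplier_iff_of_whyZ multiplier_congr_on
hP5_step_of_HFP isLandau138W_gaugeFixed_of_multiplier`).  WHAT IS REPRODUCED = the token-bearing declarations of ✓`B8Prop5KLevelLetters` under the cell's TOKEN RULE
over dag-n05-d's record twins `B8Eq138LandauZdRec.{QTZ, IsLandau138WZ, isLandau138WZ_congr}` (the Landau condition of record (1.38) over the CENTRED blocking's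
transpose stencil) and `B8Eq119TwistedAxialRec.Restr129Z` ((1.29), opaque here): §1 `isLandau138WZ_gaugeFixed_of_multiplier`; §3 `restr129Z_mul_conj_iff`; §4
`hP5_step_of_HFP`, `hP5_of_HFP`, `hP5base_of_HFP` (the sockets of `B8Thm4SupportLocalBdryRec` at `Lan := IsLandau138WZ`); §5 `restr129Z_conj_mul_iff`,
`restr129Z_driver_of_sectE`; §6 `multiplier_congr_on`, `multiplier_iff_of_whyZ`.  Every structure-free lemma of the engine module (`covDivB_logCfg_gaugeFixed`,
`bound108_of_weighted`, `mul_conj_eq`, `conj_gaugeExp_*`, `norm_conj_*`, `covDerivFwd_conj_param*`, `covLap_sub`, `gAd_sub`, `dstar_rhs_eq_*`,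
`B8Thm4TruncationLocal.base_datum`) is REUSED BY NAME.  Proofs verbatim.  Kind «kernel-checked proof», theorems only; no `def`, no `instance`, no `notation`, no
existing module modified.  `--supports stmt-QuantumFields-20541` (K0⁷-keyed, COUNT-NEUTRAL).

HONEST SCOPE: socket ADAPTERS (plain-currency fixed point ⇒ the driver's `hP5base`∕`hP5`); Proposition 5's fixed point itself is the HYPOTHESIS `hFP`∕`HFP`, NOT proved;
nothing of Bałaban's analysis re-proved; `HThm4Rec` UNDISCHARGED; caveat (C-S3-1) stands; N05 [B8] DISCHARGED OF RECORD untouched; COUNT of record unmoved by this · K 1∕4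
UNMOVED; one finite `𝕋⁴` programme at fixed `ε`, Bałaban AS PRINTED; nothing continuum ∕ ℝ⁴ ∕ OS ∕ mass-gap ∕ Clay.  No `sorry`, no `def`.

[cite: Balaban1985RegularSpaces, Prop. 5 pp.93–94, (1.106)–(1.110) p.94, (1.84)–(1.88) p.91, (1.95)–(1.96) p.92, (1.38) p.82, (1.29) p.81, (1.78) p.90; Balaban1987RG1, (0.3)–(0.4) pp.252–253]
-/

noncomputable section

open NormedSpace
open Complex (I I_ne_zero)

namespace Literature.MathematicalPhysics.QuantumFieldTheory.Balaban1983to89.B8Prop5KLevelLettersRec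

open MatrixLog B7Prop1Explicit B7Prop2Explicit B7Eq92Concrete
open B7Eq78Linearization (conjR)
open B8Ineq132 (covDerivFwd covDeriv)
open B8Eq182Proof (gAd)
open B8Eq184Proof (gaugeExp cfgExp)
open B8Eq188Proof (frakF3)
open B8Eq138LandauZd (covDivB covLap logCfg)
open B8Eq138LandauZdRec (QTZ IsLandau138Z IsLandau138WZ isLandau138WZ_congr)
open B8Eq119TwistedAxialRec (Restr129Z)
open B8Prop5KLevelLetters (covDivB_logCfg_gaugeFixed mul_conj_eq conj_mul_cancel conj_gaugeExp_funext)

-- `Site` alone could resolve to the torus sites of `Setup.lean`; re-export the `ℤ^d` sites of `B7Prop1Explicit`.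
export B7Prop1Explicit (Site)

variable {d : ℕ} {𝔸 : Type*} [NormedRing 𝔸] [NormedAlgebra ℂ 𝔸] [NormOneClass 𝔸] [CompleteSpace 𝔸]

/-! ## §1 The multiplier form of the D*-identity (1.86)–(1.88) ⇒ the Landau condition OF RECORD (centred blocking) for the gauge-fixed field -/

section DStarIdentity

/-- **The multiplier form transported**: if the linear-algebra skeleton (`B8Eq195Linear`) or any fixed-point argument delivers a
multiplier `μ` with `Δ^η_{U₀}↾Ω₀[D^{η*}_{U₀}A + Δ^η_{U₀}λ + 𝔑(λ)] = Q′(U₀)ᵀμ` on `Ω₀` (the D*-identity's right-hand side), and the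
smallness hypotheses of `covDivB_logCfg_gaugeFixed` hold at every site of `Ω₀`, then the gauge-fixed field `U₁^{v⁻¹}` satisfies the
LANDAU CONDITION OF RECORD (1.38) at `m` levels: `IsLandau138WZ L m η Ω₀ Λs U₀ (U₁^{v⁻¹})`.  (The route step (ii) of the Prop.-5 cut,
modulo the fixed point.) [cite: Balaban1985RegularSpaces, (1.38) p.82, (1.90)–(1.95) pp.91–92] -/
theorem isLandau138WZ_gaugeFixed_of_multiplier {η : ℝ} (hη : 0 < η) (L m : ℕ) (Ω₀ : Set (Site d)) (Λs : ℕ → Set (Site d))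
    (U₀ : Site d → Fin d → 𝔸ˣ) {lam : Site d → 𝔸} (A : Site d → Fin d → 𝔸)
    (hl : ∀ x ∈ Ω₀, ‖lam x‖ ≤ 1 / 12) (hD : ∀ x ∈ Ω₀, ∀ μ, η * ‖covDerivFwd η U₀ μ lam x‖ ≤ 1 / 70)
    (ha : ∀ x ∈ Ω₀, ∀ μ, η * ‖covDeriv η U₀ μ lam x‖ ≤ 1 / 70)
    (hY : ∀ x ∈ Ω₀, ∀ μ, η * ‖conjR (U₀ (x - e μ) μ)⁻¹ (A (x - e μ) μ)‖ ≤ 1 / 12)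
    (hmult : ∃ μ : ℕ → Site d → 𝔸, ∀ x ∈ Ω₀,
      covLap η U₀ (Ω₀.indicator fun y => covDivB η U₀ A y + covLap η U₀ lam y +
        ((conjR (gaugeExp lam y)⁻¹ (covDivB η U₀ A y) - covDivB η U₀ A y) +
          (gAd (covLap η U₀ lam y) (lam y) - covLap η U₀ lam y) + ∑ μ, frakF3 η U₀ lam A y μ)) x = QTZ L m Λs U₀ μ x) :
    IsLandau138WZ L m η Ω₀ Λs U₀ (mgauge U₀ (gaugeExp lam)⁻¹ (cfgExp η A)) := by
  obtain ⟨μ, hμ⟩ := hmult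
  refine ⟨μ, fun x hx => ?_⟩
  have hind : Ω₀.indicator (covDivB η U₀ (logCfg η (mgauge U₀ (gaugeExp lam)⁻¹ (cfgExp η A)))) =
      Ω₀.indicator fun y => covDivB η U₀ A y + covLap η U₀ lam y +
        ((conjR (gaugeExp lam y)⁻¹ (covDivB η U₀ A y) - covDivB η U₀ A y) +
          (gAd (covLap η U₀ lam y) (lam y) - covLap η U₀ lam y) + ∑ μ, frakF3 η U₀ lam A y μ) := by
    refine Set.indicator_congr fun y hy => ?_
    exact covDivB_logCfg_gaugeFixed hη U₀ A (hl y hy) (hD y hy) (ha y hy) (hY y hy)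
  rw [hind]
  exact hμ x hx

end DStarIdentity

/-! ## §3 Order bookkeeping for «u = u′u₁»: (1.29) (record) for the driver's `u₁·v` vs the (1.78)-chain's `u′·u₁` -/

omit [NormOneClass 𝔸] in
/-- Hence (1.29) for the driver's composite `u₁·v`, `v = u₁⁻¹u′u₁`, IS (1.29) for the (1.78)-chain's `u′·u₁`
(`B8Eq178Averages.restr129_mul_iff_cond179` then applies verbatim). [cite: Balaban1985RegularSpaces, (1.29) p.81, (1.78) p.90, (1.107) p.94] -/
theorem restr129Z_mul_conj_iff (L k : ℕ) (Λ : ℕ → Set (Site d)) (U₀ : Site d → Fin d → 𝔸ˣ) (u₁ u' : Site d → 𝔸ˣ) :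
    Restr129Z L k Λ U₀ (u₁ * (u₁⁻¹ * u' * u₁)) ↔ Restr129Z L k Λ U₀ (u' * u₁) := by
  rw [mul_conj_eq]

/-! ## §4 ASSEMBLY: the Prop.-5 sockets `hP5 m` ∕ `hP5base` of the record driver (`B8Thm4SupportLocalBdryRec` at `Lan := IsLandau138WZ`) -/

section Assembly

open B8Ineq132 (BondTouches)
open B8Eq140Level (SideTouches)
open B8Thm4TruncationLocal (base_datum)

/-- In `d ≥ 2` a bond with an end-point in `S` is a side of a plaquette touching `S` («b ∈ Ω» ⊆ the `SideTouches` bonds).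
[cite: Balaban1985RegularSpaces, p.77 (convention before (1.5))] -/
private theorem sideTouches_of_bondTouches₂ (hd2 : 2 ≤ d) {S : Set (Site d)} {y : Site d} {τ : Fin d}
    (hb : BondTouches S y τ) : SideTouches S y τ := by
  haveI : Nontrivial (Fin d) := Fin.nontrivial_iff_two_le.mpr hd2
  obtain ⟨κ, hκ⟩ := exists_ne τ
  exact B8Eq140Level.sideTouches_of_bondTouches hκ hb

variable {𝔹 : Type*} [CStarAlgebra 𝔹] [Nontrivial 𝔹]

/-- **The Prop.-5 step in plain currency ⇒ the socket `hP5 m` of the Theorem-4 driver** (one level, any `m`).  Given the datum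
of level `m` — `U₁ = e^{iηA}` on the bonds of the plaquettes touching `Ω_j`, `A` Hermitian, `|A| ≤ c⋆(Lʲη)⁻¹` (1.36) — and a
FIXED POINT `λ` displayed in plain currency: `λ` Hermitian, `λ = 0` off `Ω₀` ((1.109)), the bounds (1.108) at the `m + 1` levels,
the multiplier form of the Landau equation `Δ↾Ω₀[D*A + Δλ + 𝔑(λ)] = Q′ᵀμ` on `Ω₀` (the right-hand side of the D*-identity
(1.86)–(1.88), `covDivB_logCfg_gaugeFixed`), and (1.29) at `m + 1` levels for the composite `u₁·e^{iλ}` — the gauge transformation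
`v := e^{iλ}` is unitary, `= 1` off `Ω₀`, reads `e^{iλ}` on every bond, obeys (1.108), and `U₁^{v⁻¹}` satisfies the LANDAU CONDITION
OF RECORD (1.38) at `m + 1` levels (`isLandau138WZ_gaugeFixed_of_multiplier`, transported from `e^{iηA}` to `U₁` by locality on the
bonds «b ∈ Ω₀», `B8Eq138LandauZd.isLandau138WZ_congr`); the smallness hypotheses of (1.86)–(1.88) at the sites of `Ω₀` are READ OFF
(1.108) at level `j = 0` (`α₄ ≤ 1/84`, the backward derivative one bond back by `B8Eq151V2Divergence.norm_covDeriv_eq`) and (1.36) at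
`j = 0` (`c⋆ ≤ 1/12`).  [cite: Balaban1985RegularSpaces, Prop. 5 pp.93–94, (1.107)–(1.110) p.94, (1.86)–(1.88) p.91, (1.38) p.82] -/
theorem hP5_step_of_HFP (hd2 : 2 ≤ d) {η : ℝ} (hη : 0 < η) (L m : ℕ) {U₀ : Site d → Fin d → 𝔹ˣ}
    (hU₀ : ∀ x κ, U₀ x κ ∈ unitaryUnits 𝔹) {cstar α₄ : ℝ} (hs₁ : α₄ ≤ 1 / 84) (hcs : cstar ≤ 1 / 12)
    (Ω : ℕ → Set (Site d)) (Λs : ℕ → ℕ → Set (Site d)) (u₁ : Site d → 𝔹ˣ) (U₁ : Site d → Fin d → 𝔹ˣ) (A : Site d → Fin d → 𝔹)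
    (hdat : ∀ j, j ≤ m → ∀ b ∈ {b : Site d × Fin d | SideTouches (Ω j) b.1 b.2},
      U₁ b.1 b.2 = cfgExp η A b.1 b.2 ∧ IsSelfAdjoint (A b.1 b.2) ∧ ‖A b.1 b.2‖ ≤ cstar * ((L : ℝ) ^ j * η)⁻¹)
    (hFP : ∃ lam : Site d → 𝔹, (∀ x, IsSelfAdjoint (lam x)) ∧ (∀ x, x ∉ Ω 0 → lam x = 0) ∧
      (∀ j, j ≤ m + 1 → ∀ b ∈ {b : Site d × Fin d | SideTouches (Ω j) b.1 b.2},
        ‖lam b.1‖ ≤ α₄ ∧ ((L : ℝ) ^ j * η) * ‖covDerivFwd η U₀ b.2 lam b.1‖ ≤ α₄) ∧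
      (∃ μ : ℕ → Site d → 𝔹, ∀ x ∈ Ω 0,
        covLap η U₀ ((Ω 0).indicator fun y => covDivB η U₀ A y + covLap η U₀ lam y +
          ((conjR (gaugeExp lam y)⁻¹ (covDivB η U₀ A y) - covDivB η U₀ A y) +
            (gAd (covLap η U₀ lam y) (lam y) - covLap η U₀ lam y) + ∑ μ, frakF3 η U₀ lam A y μ)) x =
          QTZ L (m + 1) (Λs (m + 1)) U₀ μ x) ∧
      Restr129Z L (m + 1) (Λs (m + 1)) U₀ (u₁ * gaugeExp lam)) :
    ∃ (v : Site d → 𝔹ˣ) (lam : Site d → 𝔹), (∀ x, v x ∈ unitaryUnits 𝔹) ∧ (∀ x, x ∉ Ω 0 → v x = 1) ∧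
      (∀ j, j ≤ m + 1 → ∀ b ∈ {b : Site d × Fin d | SideTouches (Ω j) b.1 b.2}, (v b.1 : 𝔹) = ((gaugeExp lam b.1 : 𝔹ˣ) : 𝔹) ∧
        (v (b.1 + e b.2) : 𝔹) = ((gaugeExp lam (b.1 + e b.2) : 𝔹ˣ) : 𝔹)) ∧
      (∀ j, j ≤ m + 1 → ∀ b ∈ {b : Site d × Fin d | SideTouches (Ω j) b.1 b.2},
        ‖lam b.1‖ ≤ α₄ ∧ ((L : ℝ) ^ j * η) * ‖covDerivFwd η U₀ b.2 lam b.1‖ ≤ α₄) ∧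
      IsLandau138WZ L (m + 1) η (Ω 0) (Λs (m + 1)) U₀ (mgauge U₀ v⁻¹ U₁) ∧ Restr129Z L (m + 1) (Λs (m + 1)) U₀ (u₁ * v) := by
  obtain ⟨lam, hsa, hoff, h108, hmult, h129⟩ := hFP
  have hE0 : ∀ {y : Site d} {τ : Fin d}, BondTouches (Ω 0) y τ → (y, τ) ∈ {b : Site d × Fin d | SideTouches (Ω 0) b.1 b.2} :=
    fun hb => sideTouches_of_bondTouches₂ hd2 hb
  have hα12 : α₄ ≤ 1 / 12 := hs₁.trans (by norm_num)
  have hα70 : α₄ ≤ 1 / 70 := hs₁.trans (by norm_num)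
  have hd1 : 0 < d := by omega
  -- (1.108) at level `j = 0` on the bonds touching `Ω₀`
  have h0 : ∀ y τ, BondTouches (Ω 0) y τ → ‖lam y‖ ≤ α₄ ∧ η * ‖covDerivFwd η U₀ τ lam y‖ ≤ α₄ := fun y τ hb => by
    simpa only [pow_zero, one_mul] using h108 0 (Nat.zero_le _) (y, τ) (hE0 hb)
  have hl : ∀ x ∈ Ω 0, ‖lam x‖ ≤ 1 / 12 := fun x hx => (h0 x ⟨0, hd1⟩ (Or.inl hx)).1.trans hα12
  have hD : ∀ x ∈ Ω 0, ∀ μ, η * ‖covDerivFwd η U₀ μ lam x‖ ≤ 1 / 70 := fun x hx μ => (h0 x μ (Or.inl hx)).2.trans hα70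
  have hback : ∀ x ∈ Ω 0, ∀ μ : Fin d, BondTouches (Ω 0) (x - e μ) μ := fun x hx μ => Or.inr (by rwa [sub_add_cancel])
  have ha : ∀ x ∈ Ω 0, ∀ μ, η * ‖covDeriv η U₀ μ lam x‖ ≤ 1 / 70 := fun x hx μ => by
    rw [B8Eq151V2Divergence.norm_covDeriv_eq (unitaryUnits_le_U1 (hU₀ _ _)) lam]
    exact (h0 _ μ (hback x hx μ)).2.trans hα70
  have hY : ∀ x ∈ Ω 0, ∀ μ, η * ‖conjR (U₀ (x - e μ) μ)⁻¹ (A (x - e μ) μ)‖ ≤ 1 / 12 := fun x hx μ => by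
    obtain ⟨-, -, hA⟩ := hdat 0 (Nat.zero_le _) (x - e μ, μ) (hE0 (hback x hx μ))
    rw [B8Ineq132.norm_conjR ((U1 𝔹).inv_mem (unitaryUnits_le_U1 (hU₀ _ _)))]
    rw [pow_zero, one_mul] at hA
    calc η * ‖A (x - e μ) μ‖ ≤ η * (cstar * η⁻¹) := mul_le_mul_of_nonneg_left hA hη.le
      _ = cstar := by rw [mul_left_comm, mul_inv_cancel₀ hη.ne', mul_one]
      _ ≤ 1 / 12 := hcs
  have hLan : IsLandau138WZ L (m + 1) η (Ω 0) (Λs (m + 1)) U₀ (mgauge U₀ (gaugeExp lam)⁻¹ (cfgExp η A)) :=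
    isLandau138WZ_gaugeFixed_of_multiplier hη L (m + 1) (Ω 0) (Λs (m + 1)) U₀ A hl hD ha hY hmult
  have hcongr : ∀ (x : Site d) (μ : Fin d), BondTouches (Ω 0) x μ →
      mgauge U₀ (gaugeExp lam)⁻¹ U₁ x μ = mgauge U₀ (gaugeExp lam)⁻¹ (cfgExp η A) x μ := fun x μ hb => by
    rw [mgauge_apply, mgauge_apply, (hdat 0 (Nat.zero_le _) (x, μ) (hE0 hb)).1]
  refine ⟨gaugeExp lam, lam, fun x => ?_, fun x hx => ?_, fun j _ b _ => ⟨rfl, rfl⟩, h108,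
    (isLandau138WZ_congr hcongr).mpr hLan, h129⟩
  · exact mem_unitaryUnits.mpr (B8Ineq170.exp_I_smul_mem_unitary (hsa x))
  · exact Units.ext (by rw [gaugeExp, hoff x hx, smul_zero, val_expUnit, NormedSpace.exp_zero, Units.val_one])

/-- **The socket `hP5` of `B8Thm4SupportLocal.thm4_exists_all_levels_supp_landau138`, verbatim, from the fixed point in plain
currency at every level `1 ≤ m < k`.**  The hypothesis `HFP` is the Prop.-5 fixed point (1.106)/(1.107) — produced on the k-level
λ-space by the contraction (1.103)–(1.105) (`B8Prop5ContractionKLevel`, Hölder letters `G′, C, H′` of (1.99)–(1.101)) — handed over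
as: `λ` Hermitian and `= 0` off `Ω₀`, (1.108) at the `m + 1` levels, the multiplier form of `Δ↾Ω₀ D*[(1/iη) log U₁^{v⁻¹}] = Q′ᵀμ`
with the D*-identity's right-hand side, and (1.29) for `u₁·e^{iλ}` (Sect. E); it receives every premise the driver gives the socket.
[cite: Balaban1985RegularSpaces, Prop. 5 pp.93–94, (1.106)–(1.110) p.94, Theorem 4 p.82] -/
theorem hP5_of_HFP (hd2 : 2 ≤ d) {η : ℝ} (hη : 0 < η) (L k : ℕ) {U₀ U' : Site d → Fin d → 𝔹ˣ}
    (hU₀ : ∀ x κ, U₀ x κ ∈ unitaryUnits 𝔹) {cstar α₄ : ℝ} (hs₁ : α₄ ≤ 1 / 84) (hcs : cstar ≤ 1 / 12)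
    (Ω : ℕ → Set (Site d)) (Λs : ℕ → ℕ → Set (Site d))
    (HFP : ∀ m, 1 ≤ m → m < k → ∀ (u₁ : Site d → 𝔹ˣ) (U₁ : Site d → Fin d → 𝔹ˣ) (A : Site d → Fin d → 𝔹),
      (∀ x, u₁ x ∈ unitaryUnits 𝔹) → (∀ x, x ∉ Ω 0 → u₁ x = 1) → mgauge U₀ u₁ U₁ = U' → Restr129Z L m (Λs m) U₀ u₁ →
      IsLandau138WZ L m η (Ω 0) (Λs m) U₀ U₁ →
      (∀ j, j ≤ m → ∀ b ∈ {b : Site d × Fin d | SideTouches (Ω j) b.1 b.2},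
        U₁ b.1 b.2 = cfgExp η A b.1 b.2 ∧ IsSelfAdjoint (A b.1 b.2) ∧ ‖A b.1 b.2‖ ≤ cstar * ((L : ℝ) ^ j * η)⁻¹) →
      ∃ lam : Site d → 𝔹, (∀ x, IsSelfAdjoint (lam x)) ∧ (∀ x, x ∉ Ω 0 → lam x = 0) ∧
        (∀ j, j ≤ m + 1 → ∀ b ∈ {b : Site d × Fin d | SideTouches (Ω j) b.1 b.2},
          ‖lam b.1‖ ≤ α₄ ∧ ((L : ℝ) ^ j * η) * ‖covDerivFwd η U₀ b.2 lam b.1‖ ≤ α₄) ∧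
        (∃ μ : ℕ → Site d → 𝔹, ∀ x ∈ Ω 0,
          covLap η U₀ ((Ω 0).indicator fun y => covDivB η U₀ A y + covLap η U₀ lam y +
            ((conjR (gaugeExp lam y)⁻¹ (covDivB η U₀ A y) - covDivB η U₀ A y) +
              (gAd (covLap η U₀ lam y) (lam y) - covLap η U₀ lam y) + ∑ μ, frakF3 η U₀ lam A y μ)) x =
            QTZ L (m + 1) (Λs (m + 1)) U₀ μ x) ∧
        Restr129Z L (m + 1) (Λs (m + 1)) U₀ (u₁ * gaugeExp lam)) :
    ∀ m, 1 ≤ m → m < k → ∀ (u₁ : Site d → 𝔹ˣ) (U₁ : Site d → Fin d → 𝔹ˣ) (A : Site d → Fin d → 𝔹),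
      (∀ x, u₁ x ∈ unitaryUnits 𝔹) → (∀ x, x ∉ Ω 0 → u₁ x = 1) → mgauge U₀ u₁ U₁ = U' → Restr129Z L m (Λs m) U₀ u₁ →
      IsLandau138WZ L m η (Ω 0) (Λs m) U₀ U₁ →
      (∀ j, j ≤ m → ∀ b ∈ {b : Site d × Fin d | SideTouches (Ω j) b.1 b.2},
        U₁ b.1 b.2 = cfgExp η A b.1 b.2 ∧ IsSelfAdjoint (A b.1 b.2) ∧ ‖A b.1 b.2‖ ≤ cstar * ((L : ℝ) ^ j * η)⁻¹) →
      ∃ (v : Site d → 𝔹ˣ) (lam : Site d → 𝔹), (∀ x, v x ∈ unitaryUnits 𝔹) ∧ (∀ x, x ∉ Ω 0 → v x = 1) ∧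
        (∀ j, j ≤ m + 1 → ∀ b ∈ {b : Site d × Fin d | SideTouches (Ω j) b.1 b.2}, (v b.1 : 𝔹) = ((gaugeExp lam b.1 : 𝔹ˣ) : 𝔹) ∧
          (v (b.1 + e b.2) : 𝔹) = ((gaugeExp lam (b.1 + e b.2) : 𝔹ˣ) : 𝔹)) ∧
        (∀ j, j ≤ m + 1 → ∀ b ∈ {b : Site d × Fin d | SideTouches (Ω j) b.1 b.2},
          ‖lam b.1‖ ≤ α₄ ∧ ((L : ℝ) ^ j * η) * ‖covDerivFwd η U₀ b.2 lam b.1‖ ≤ α₄) ∧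
        IsLandau138WZ L (m + 1) η (Ω 0) (Λs (m + 1)) U₀ (mgauge U₀ v⁻¹ U₁) ∧ Restr129Z L (m + 1) (Λs (m + 1)) U₀ (u₁ * v) :=
  fun m hm hmk u₁ U₁ A hu₁ hsupp hfix h129 hLan hdat =>
    hP5_step_of_HFP hd2 hη L m hU₀ hs₁ hcs Ω Λs u₁ U₁ A hdat (HFP m hm hmk u₁ U₁ A hu₁ hsupp hfix h129 hLan hdat)

/-- **The socket `hP5base` of `B8Thm4SupportLocal.thm4_exists_all_levels_supp_landau138`, verbatim** (the first step `u₁ = 1`,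
`U₁ = U′`): by (1.66) `|U′ − 1| ≤ a ≤ 1/4` on the bonds of the plaquettes touching `Ω₀`, so `U′ = e^{iηA₀}` there with
`A₀ := (iη)⁻¹ log U′` Hermitian and `|A₀| ≤ 2aη⁻¹ ≤ c⋆η⁻¹` (`B8Thm4TruncationLocal.base_datum`) — the datum of level `0` — and the
plain-currency fixed point `HFP₀` for that datum gives the socket by `hP5_step_of_HFP` at `m = 0`.
[cite: Balaban1985RegularSpaces, Prop. 5 pp.93–94, (1.66) p.88, (1.106)–(1.110) p.94] -/
theorem hP5base_of_HFP (hd2 : 2 ≤ d) {η : ℝ} (hη : 0 < η) (L : ℕ) {U₀ U' : Site d → Fin d → 𝔹ˣ}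
    (hU₀ : ∀ x κ, U₀ x κ ∈ unitaryUnits 𝔹) (hU' : ∀ x κ, U' x κ ∈ unitaryUnits 𝔹) {cstar α₄ a : ℝ} (hs₁ : α₄ ≤ 1 / 84)
    (hcs : cstar ≤ 1 / 12) (ha : a ≤ 1 / 4) (ha2 : 2 * a ≤ cstar) (Ω : ℕ → Set (Site d)) (Λs : ℕ → ℕ → Set (Site d))
    (h66 : ∀ b ∈ {b : Site d × Fin d | SideTouches (Ω 0) b.1 b.2}, ‖((U' b.1 b.2 : 𝔹ˣ) : 𝔹) - 1‖ ≤ a)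
    (HFP₀ : ∀ A : Site d → Fin d → 𝔹,
      (∀ j, j ≤ 0 → ∀ b ∈ {b : Site d × Fin d | SideTouches (Ω j) b.1 b.2},
        U' b.1 b.2 = cfgExp η A b.1 b.2 ∧ IsSelfAdjoint (A b.1 b.2) ∧ ‖A b.1 b.2‖ ≤ cstar * ((L : ℝ) ^ j * η)⁻¹) →
      ∃ lam : Site d → 𝔹, (∀ x, IsSelfAdjoint (lam x)) ∧ (∀ x, x ∉ Ω 0 → lam x = 0) ∧
        (∀ j, j ≤ 1 → ∀ b ∈ {b : Site d × Fin d | SideTouches (Ω j) b.1 b.2},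
          ‖lam b.1‖ ≤ α₄ ∧ ((L : ℝ) ^ j * η) * ‖covDerivFwd η U₀ b.2 lam b.1‖ ≤ α₄) ∧
        (∃ μ : ℕ → Site d → 𝔹, ∀ x ∈ Ω 0,
          covLap η U₀ ((Ω 0).indicator fun y => covDivB η U₀ A y + covLap η U₀ lam y +
            ((conjR (gaugeExp lam y)⁻¹ (covDivB η U₀ A y) - covDivB η U₀ A y) +
              (gAd (covLap η U₀ lam y) (lam y) - covLap η U₀ lam y) + ∑ μ, frakF3 η U₀ lam A y μ)) x =
            QTZ L 1 (Λs 1) U₀ μ x) ∧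
        Restr129Z L 1 (Λs 1) U₀ ((1 : Site d → 𝔹ˣ) * gaugeExp lam)) :
    ∃ (v : Site d → 𝔹ˣ) (lam : Site d → 𝔹), (∀ x, v x ∈ unitaryUnits 𝔹) ∧ (∀ x, x ∉ Ω 0 → v x = 1) ∧
      (∀ j, j ≤ 1 → ∀ b ∈ {b : Site d × Fin d | SideTouches (Ω j) b.1 b.2}, (v b.1 : 𝔹) = ((gaugeExp lam b.1 : 𝔹ˣ) : 𝔹) ∧
        (v (b.1 + e b.2) : 𝔹) = ((gaugeExp lam (b.1 + e b.2) : 𝔹ˣ) : 𝔹)) ∧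
      (∀ j, j ≤ 1 → ∀ b ∈ {b : Site d × Fin d | SideTouches (Ω j) b.1 b.2},
        ‖lam b.1‖ ≤ α₄ ∧ ((L : ℝ) ^ j * η) * ‖covDerivFwd η U₀ b.2 lam b.1‖ ≤ α₄) ∧
      IsLandau138WZ L 1 η (Ω 0) (Λs 1) U₀ (mgauge U₀ v⁻¹ U') ∧ Restr129Z L 1 (Λs 1) U₀ ((1 : Site d → 𝔹ˣ) * v) := by
  set A₀ : Site d → Fin d → 𝔹 := fun y μ => η⁻¹ • ((I⁻¹ : ℂ) • mlog ((U' y μ : 𝔹ˣ) : 𝔹))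
  have hdat : ∀ j, j ≤ 0 → ∀ b ∈ {b : Site d × Fin d | SideTouches (Ω j) b.1 b.2},
      U' b.1 b.2 = cfgExp η A₀ b.1 b.2 ∧ IsSelfAdjoint (A₀ b.1 b.2) ∧ ‖A₀ b.1 b.2‖ ≤ cstar * ((L : ℝ) ^ j * η)⁻¹ := by
    intro j hj b hb
    obtain rfl : j = 0 := Nat.le_zero.mp hj
    obtain ⟨-, hexp, hsa, hn⟩ := base_datum hη U₀ U' hU' ha b.1 b.2 (h66 b hb)
    refine ⟨hexp, hsa, hn.trans ?_⟩
    rw [pow_zero, one_mul]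
    exact mul_le_mul_of_nonneg_right ha2 (inv_nonneg.mpr hη.le)
  exact hP5_step_of_HFP hd2 hη L 0 hU₀ hs₁ hcs Ω Λs 1 U' A₀ hdat (HFP₀ A₀ hdat)

end Assembly

/-! ## §5 The order recipe under ruling (a): the Sect.-E factor is the conjugate `u′ := u₁·v·u₁⁻¹` (record (1.29)) -/

omit [NormOneClass 𝔸] in
/-- Hence (1.29) for `u′·u₁`, `u′ = u₁vu₁⁻¹` (the currency of `B8Eq178Averages.restr129_mul_iff_cond179`), IS (1.29) for the driver's
`u₁·v`. [cite: Balaban1985RegularSpaces, (1.29) p.81, (1.78) p.90, (1.107) p.94] -/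
theorem restr129Z_conj_mul_iff (L k : ℕ) (Λ : ℕ → Set (Site d)) (U₀ : Site d → Fin d → 𝔸ˣ) (u₁ v : Site d → 𝔸ˣ) :
    Restr129Z L k Λ U₀ (u₁ * v * u₁⁻¹ * u₁) ↔ Restr129Z L k Λ U₀ (u₁ * v) := by
  rw [conj_mul_cancel]

omit [NormOneClass 𝔸] in
/-- **THE RECIPE.** If the (1.78)/Sect.-E chain delivers (1.29) at the `k` levels for the composite `e^{i·Ad(u₁)λ}·u₁` — i.e. its `u′` is
fed the CONJUGATED parameter `Ad(u₁)λ` — then (1.29) holds for the driver's composite `u₁·e^{iλ}` with the ORIGINAL parameter `λ`, the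
one at which the Landau clause ((1.84)–(1.88), `covDivB_logCfg_gaugeFixed`) is read: both clauses of the plain-currency fixed point `HFP`
(`hP5_step_of_HFP`) are then about the same `λ`. [cite: Balaban1985RegularSpaces, (1.29) p.81, (1.106)–(1.107) p.94, Sect. E p.95] -/
theorem restr129Z_driver_of_sectE (L k : ℕ) (Λ : ℕ → Set (Site d)) (U₀ : Site d → Fin d → 𝔸ˣ) (u₁ : Site d → 𝔸ˣ) (lam : Site d → 𝔸)
    (h : Restr129Z L k Λ U₀ (gaugeExp (fun y => conjR (u₁ y) (lam y)) * u₁)) :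
    Restr129Z L k Λ U₀ (u₁ * gaugeExp lam) := by
  rw [← conj_gaugeExp_funext, restr129Z_conj_mul_iff] at h
  exact h

/-! ## §6 The «WHY Z» algebra: the multiplier clause only reads its source on `Ω₀` (record stencil `QTZ`) -/

section WhyZ

omit [NormOneClass 𝔸] in
/-- The multiplier clause of the plain-currency fixed point only reads its source ON `Ω₀`: two sources that agree on `Ω₀` give the same
clause (the indicator `↾Ω₀` sits inside `Δ^η_{U₀}`, as in `IsLandau138WZ`). [cite: Balaban1985RegularSpaces, (1.38) p.82, (1.95) p.92] -/
theorem multiplier_congr_on {η : ℝ} (L m : ℕ) (Ω₀ : Set (Site d)) (Λs : ℕ → Set (Site d)) (U₀ : Site d → Fin d → 𝔸ˣ)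
    {F G : Site d → 𝔸} (h : ∀ y ∈ Ω₀, F y = G y) :
    (∃ μ : ℕ → Site d → 𝔸, ∀ x ∈ Ω₀, covLap η U₀ (Ω₀.indicator F) x = QTZ L m Λs U₀ μ x) ↔
      ∃ μ : ℕ → Site d → 𝔸, ∀ x ∈ Ω₀, covLap η U₀ (Ω₀.indicator G) x = QTZ L m Λs U₀ μ x := by
  rw [Set.indicator_congr h]

omit [NormOneClass 𝔸] in
/-- **Corollary (the multiplier clause of `HFP` after «WHY Z»).**  Under the Neumann equation and `Δλ = −RZ` on `Ω₀` (and
`|λ′| ≤ 1/12` there), the multiplier clause of `hP5_step_of_HFP` for `λ′` IS the statement `∃ μ, Δ^η_{U₀}↾Ω₀(Z − RZ) = Q′ᵀμ` on `Ω₀` —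
which the projection law «R(Z − RZ) = 0 ⟹ multiplier» (`B8Eq138Multiplier.proj325_apply_eq_zero_iff_exists` at the concrete letters)
discharges. [cite: Balaban1985RegularSpaces, (1.95)–(1.96) p.92, (1.106) p.94, (1.38) p.82] -/
theorem multiplier_iff_of_whyZ {η : ℝ} (L m : ℕ) (Ω₀ : Set (Site d)) (Λs : ℕ → Set (Site d)) (U₀ : Site d → Fin d → 𝔸ˣ)
    (A : Site d → Fin d → 𝔸) {lam lam' Hc Z RZ : Site d → 𝔸} (hdef : lam' = lam - Hc) (hl : ∀ y ∈ Ω₀, ‖lam' y‖ ≤ 1 / 12)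
    (hN : ∀ y ∈ Ω₀, Z y + (gAd (RZ y) (lam' y) - RZ y) =
      conjR (gaugeExp lam' y)⁻¹ (covDivB η U₀ A y) - gAd (covLap η U₀ Hc y) (lam' y) + ∑ μ, frakF3 η U₀ lam' A y μ)
    (hΔ : ∀ y ∈ Ω₀, covLap η U₀ lam y = -RZ y) :
    (∃ μ : ℕ → Site d → 𝔸, ∀ x ∈ Ω₀,
      covLap η U₀ (Ω₀.indicator fun y => covDivB η U₀ A y + covLap η U₀ lam' y +
        ((conjR (gaugeExp lam' y)⁻¹ (covDivB η U₀ A y) - covDivB η U₀ A y) +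
          (gAd (covLap η U₀ lam' y) (lam' y) - covLap η U₀ lam' y) + ∑ μ, frakF3 η U₀ lam' A y μ)) x = QTZ L m Λs U₀ μ x) ↔
      ∃ μ : ℕ → Site d → 𝔸, ∀ x ∈ Ω₀, covLap η U₀ (Ω₀.indicator (Z - RZ)) x = QTZ L m Λs U₀ μ x :=
  multiplier_congr_on L m Ω₀ Λs U₀ fun y hy => by
    rw [Pi.sub_apply]
    exact B8Prop5KLevelLetters.dstar_rhs_eq_Z_sub_RZ U₀ A hdef (hl y hy) (hN y hy) (hΔ y hy)

end WhyZ

end Literature.MathematicalPhysics.QuantumFieldTheory.Balaban1983to89.B8Prop5KLevelLettersRec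

end
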